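import Mathlib
import Summits.NavierStokesRegularity.NavierStokesRegularity.Theorems.OrthantWakeOrthantBreakOfWake
import HarnessLib

/-!
# `OrthantWake.ForwardSourceSmoothing` — TOOLS: shell energy identity, flux bound through the
sources, linear decay, and one bootstrap pass (helper file for item
stmt-NavierStokesRegularity-26374, `--supports`; the item itself is proved in
`OrthantWakeForwardSourceSmoothing.lean` from these tools)

**Statement (verbatim route decl).** For `ε₀, η > 0`, a table `α ∈ E₂(R)`, a set of modes `S`
containing every forward source (`i ∉ S ⇒ α i j l (0,0,1) = 0`), a datum `X₀` and `ν > 0`: if on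
every horizon `[0,T]` the `S`-mode partial tail energies of all regular `ν`-viscous solutions on
sub-windows `[0,s]` obey `Σ_{k=n}^{N} Σ_{i∈S} ½X_{i,k}(t)² ≤ C(T)(1+ε₀)^{-(1+η)n}`, then a GLOBAL
regular solution of the `ν`-viscous lattice exists (`ViscousGlobal ε₀ ν α X₀ X`).

PROOF (slaving of the non-source modes by a finite bootstrap at FIXED `ν`; no sign condition).
Write `λ = 1+ε₀`, `e_k = Σ_i ½X_{i,k}²` (ALL modes of shell `k`), `Π_k = botSum ε₀ α X k` (the bond
flux `k → k+1`).
* SHELL ENERGY IDENTITY (`forwardSmoothing_hasDerivWithinAt_shellEnergy`): by the cancellation (4.3)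
  the in-shell and rotor terms drop out of the energy of a whole shell,
  `e_k' = Π_{k-1} − Π_k − 2νλ^{2k} e_k` (Tao's telescoping `Σ_i quadTerm_{i,k} X_{i,k} = A(k) + B(k-1)`,
  `B(k) = −A(k)`).
* FLUX BOUND (`forwardSmoothing_abs_botSum_le`): every term of `Π_k` carries a coefficient
  `α_{i₁i₂i₃,(0,0,1)}` which VANISHES unless its first input `i₁` is a source, `i₁ ∈ S`; hence
  `|Π_k| ≤ 64 λ^{5k/2} · A · B · B'` from `|X_{i,k}| ≤ A (i ∈ S)`, `|X_{i,k}| ≤ B`, `|X_{i,k+1}| ≤ B'`.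
* LINEAR DECAY (`forwardSmoothing_le_of_linearDecay`): `f' ≤ −c f + F`, `f(0) ≤ 0`, `c > 0` give
  `f ≤ F/c` (Grönwall with negative rate).
* ONE PASS (`forwardSmoothing_pass`): if `Σ_{i∈S}½X_{i,k}² ≤ Cλ^{-(1+η)k}` (`η ≤ 1`) and
  `e_k ≤ Kλ^{-ak}` (`0 ≤ a ≤ 1`) for all shells and times, then `|Π_{k-1}|, |Π_k| ≤ 128√(2C)K λ^{(2−η/2−a)k}`
  and the decay lemma at rate `c = 2νλ^{2k}` gives `e_k ≤ (128√(2C)K/ν) λ^{-(a+η/2)k}` for `k ≥ 1`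
  (`e_0 ≤ E₀` by the energy inequality): the all-mode exponent GAINS `η/2` per pass.
* ITERATION (`forwardSourceSmoothing_proof`): start from `a = 0` (`e_k ≤ E₀`, `orthantBreak_energy_le`),
  run `J = ⌊2/η₀⌋ + 1` passes with `η₀ = min η 1` to reach the exponent `a_J = Jη₀/2 > 1`, sum the
  geometric series over `k ∈ [n, N]`, and feed the resulting ALL-MODE envelope (exponent `1+η'`,
  `η' = a_J − 1 > 0`, constant depending on `C(T), ν, E₀, ε₀, η` only) to the landed engine
  `exists_viscousGlobal_of_subcriticalEnvelope_of_inTableClass` (p593260 lineage).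

HONEST FRAMING: statements about Tao-type MODEL lattice ODEs (routes OrthantWake /
SubcriticalEnvelope, rung TL-M2Break); this is the smoothing half only — the forward-source ratchet
/ envelope (the content) is NOT proved here; nothing bears on Navier–Stokes regularity and no
summit is proved.
-/

noncomputable section

-- the sub-problem namespace `NavierStokesRegularity.NavierStokesRegularity` is the tree's layout (D-0017)
set_option linter.dupNamespace false

namespace Summit.NavierStokesRegularity.NavierStokesRegularity.Theorems

open Set Filter
open scoped Topology
open Literature.Analysis.FluidPDE.TaoCascade

/-! ## §1 Shell energy identity, flux bound, linear decay -/

/-- **Shell energy identity.** For a cancelling table and a solution of the `ν`-viscous lattice on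
`[0,s]`, the energy of the whole shell `k`, `e_k(w) = Σ_i ½X_{i,k}(w)²`, has derivative
`Π_{k-1} − Π_k − νλ^{2k} Σ_i X_{i,k}²` within `[0,s]` (in-shell triads and rotors cancel by (4.3)).
[this file] -/
theorem forwardSmoothing_hasDerivWithinAt_shellEnergy {ε₀ ν s : ℝ}
    {α : Fin 4 → Fin 4 → Fin 4 → ℤ × ℤ × ℤ → ℝ} (hc : IsCancellingCoeff α)
    {X : Fin 4 → ℤ → ℝ → ℝ}
    (hder : ∀ (i : Fin 4) (k : ℤ), ∀ t ∈ Icc (0 : ℝ) s, HasDerivWithinAt (X i k)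
      (quadTerm ε₀ α X i k t - ν * (1 + ε₀) ^ ((2 : ℝ) * k) * X i k t) (Icc (0 : ℝ) s) t)
    (k : ℤ) {u : ℝ} (hu : u ∈ Icc (0 : ℝ) s) :
    HasDerivWithinAt (fun w => ∑ i : Fin 4, (1 / 2 : ℝ) * X i k w ^ 2)
      (botSum ε₀ α X (k - 1) u - botSum ε₀ α X k u -
        ν * (1 + ε₀) ^ ((2 : ℝ) * k) * ∑ i : Fin 4, X i k u ^ 2) (Icc (0 : ℝ) s) u := by
  have h := HasDerivWithinAt.fun_sum (u := Finset.univ)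
    fun (i : Fin 4) (_ : i ∈ Finset.univ) => ((hder i k u hu).pow 2).const_mul (1 / 2 : ℝ)
  refine h.congr_deriv ?_
  have hsq := sum_quadTerm_mul ε₀ α X k u
  rw [botSum_eq_neg_topSum ε₀ hc X k u]
  calc ∑ i : Fin 4, (1 / 2 : ℝ) * (((2 : ℕ) : ℝ) * X i k u ^ (2 - 1) *
          (quadTerm ε₀ α X i k u - ν * (1 + ε₀) ^ ((2 : ℝ) * k) * X i k u))
      = (∑ i : Fin 4, quadTerm ε₀ α X i k u * X i k u) -
          ν * (1 + ε₀) ^ ((2 : ℝ) * k) * ∑ i : Fin 4, X i k u ^ 2 := by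
        rw [Finset.mul_sum, ← Finset.sum_sub_distrib]
        refine Finset.sum_congr rfl fun i _ => ?_
        push_cast
        ring
    _ = _ := by rw [hsq]; ring

/-- **Flux bound through the sources.** If every `(0,0,1)` coefficient has modulus `≤ 1` and
vanishes unless its first input lies in `S`, then
`|Π_k| ≤ 64 (1+ε₀)^{5k/2} · A · B · B'` whenever `|X_{i,k}| ≤ A` for `i ∈ S`, `|X_{i,k}| ≤ B` for all
`i` and `|X_{i,k+1}| ≤ B'` for all `i`. [this file] -/
theorem forwardSmoothing_abs_botSum_le {ε₀ : ℝ} (h0 : 0 < 1 + ε₀)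
    {α : Fin 4 → Fin 4 → Fin 4 → ℤ × ℤ × ℤ → ℝ} (hα1 : ∀ i₁ i₂ i₃, |α i₁ i₂ i₃ (0, 0, 1)| ≤ 1)
    {S : Finset (Fin 4)} (hS : ∀ i, i ∉ S → ∀ j l : Fin 4, α i j l (0, 0, 1) = 0)
    {X : Fin 4 → ℤ → ℝ → ℝ} {k : ℤ} {u A B B' : ℝ} (hA : 0 ≤ A) (hB : 0 ≤ B) (hB' : 0 ≤ B')
    (hSk : ∀ i ∈ S, |X i k u| ≤ A) (hbk : ∀ i, |X i k u| ≤ B) (hbk1 : ∀ i, |X i (k + 1) u| ≤ B') :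
    |botSum ε₀ α X k u| ≤ 64 * (1 + ε₀) ^ ((5 : ℝ) * k / 2) * (A * B * B') := by
  set sc : ℝ := (1 + ε₀) ^ ((5 : ℝ) * k / 2) with hsc
  have hsc0 : 0 ≤ sc := (Real.rpow_pos_of_pos h0 _).le
  have hterm : ∀ i₁ i₂ i₃ : Fin 4,
      |α i₁ i₂ i₃ (0, 0, 1) * sc * (X i₁ k u * X i₂ k u * X i₃ (k + 1) u)| ≤ sc * (A * B * B') := by
    intro i₁ i₂ i₃
    by_cases hi : i₁ ∈ S
    · rw [abs_mul, abs_mul, abs_mul, abs_mul, abs_of_nonneg hsc0]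
      have h1 := hα1 i₁ i₂ i₃
      have h2 := hSk i₁ hi
      have h3 := hbk i₂
      have h4 := hbk1 i₃
      have hprod : |X i₁ k u| * |X i₂ k u| * |X i₃ (k + 1) u| ≤ A * B * B' :=
        mul_le_mul (mul_le_mul h2 h3 (abs_nonneg _) hA) h4 (abs_nonneg _) (mul_nonneg hA hB)
      calc |α i₁ i₂ i₃ (0, 0, 1)| * sc * (|X i₁ k u| * |X i₂ k u| * |X i₃ (k + 1) u|)
          ≤ 1 * sc * (A * B * B') :=
            mul_le_mul (mul_le_mul_of_nonneg_right h1 hsc0) hprod (by positivity) (by positivity)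
        _ = sc * (A * B * B') := by ring
    · rw [hS i₁ hi i₂ i₃]
      simp only [zero_mul, abs_zero]
      positivity
  unfold botSum
  calc |∑ i₁ : Fin 4, ∑ i₂ : Fin 4, ∑ i₃ : Fin 4,
        α i₁ i₂ i₃ (0, 0, 1) * sc * (X i₁ k u * X i₂ k u * X i₃ (k + 1) u)|
      ≤ ∑ i₁ : Fin 4, ∑ i₂ : Fin 4, ∑ i₃ : Fin 4,
        |α i₁ i₂ i₃ (0, 0, 1) * sc * (X i₁ k u * X i₂ k u * X i₃ (k + 1) u)| := by
          refine (Finset.abs_sum_le_sum_abs _ _).trans (Finset.sum_le_sum fun i₁ _ => ?_)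
          refine (Finset.abs_sum_le_sum_abs _ _).trans (Finset.sum_le_sum fun i₂ _ => ?_)
          exact Finset.abs_sum_le_sum_abs _ _
    _ ≤ ∑ _i₁ : Fin 4, ∑ _i₂ : Fin 4, ∑ _i₃ : Fin 4, sc * (A * B * B') :=
          Finset.sum_le_sum fun i₁ _ => Finset.sum_le_sum fun i₂ _ =>
            Finset.sum_le_sum fun i₃ _ => hterm i₁ i₂ i₃
    _ = 64 * sc * (A * B * B') := by
          simp only [Finset.sum_const, Finset.card_univ, Fintype.card_fin, nsmul_eq_mul]
          push_cast
          ring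

/-- **Linear decay bound (Grönwall with negative rate).** If `f` is differentiable within `[0,s]`
with `f' ≤ −c f + F` there (`c > 0`, `F ≥ 0`) and `f(0) ≤ 0`, then `f ≤ F/c` on `[0,s]`.
[this file] -/
theorem forwardSmoothing_le_of_linearDecay {f f' : ℝ → ℝ} {s c F : ℝ} (hc : 0 < c) (hF : 0 ≤ F)
    (hder : ∀ u ∈ Icc (0 : ℝ) s, HasDerivWithinAt f (f' u) (Icc (0 : ℝ) s) u)
    (hbound : ∀ u ∈ Icc (0 : ℝ) s, f' u ≤ -c * f u + F) (hf0 : f 0 ≤ 0)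
    {t : ℝ} (ht : t ∈ Icc (0 : ℝ) s) : f t ≤ F / c := by
  have hcontOn : ContinuousOn f (Icc 0 s) := fun u hu => (hder u hu).continuousWithinAt
  have hderiv : ∀ x ∈ Ico (0 : ℝ) s, HasDerivWithinAt f (f' x) (Ici x) x := by
    intro x hx
    refine (hder x ⟨hx.1, hx.2.le⟩).mono_of_mem_nhdsWithin ?_
    exact mem_of_superset (Icc_mem_nhdsGE hx.2) (Icc_subset_Icc hx.1 le_rfl)
  have hf' : ∀ x ∈ Ico (0 : ℝ) s, ∀ r, f' x < r →
      ∃ᶠ z in 𝓝[>] x, (z - x)⁻¹ * (f z - f x) < r := by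
    intro x hx r hr
    have h := (hderiv x hx).liminf_right_slope_le hr
    refine h.mono fun z hz => ?_
    rw [slope_def_field, div_eq_inv_mul] at hz
    exact hz
  have hbound' : ∀ x ∈ Ico (0 : ℝ) s, f' x ≤ -c * f x + F := fun x hx => hbound x ⟨hx.1, hx.2.le⟩
  have hG := le_gronwallBound_of_liminf_deriv_right_le hcontOn hf' le_rfl hbound' t ht
  rw [gronwallBound_of_K_ne_0 (neg_ne_zero.2 hc.ne'), sub_zero] at hG
  have hexp0 : 0 < Real.exp (-c * t) := Real.exp_pos _
  have hexp1 : Real.exp (-c * t) ≤ 1 := by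
    apply Real.exp_le_one_iff.2
    nlinarith [hc, ht.1]
  have h1 : f 0 * Real.exp (-c * t) ≤ 0 := mul_nonpos_of_nonpos_of_nonneg hf0 hexp0.le
  have h2 : F / -c * (Real.exp (-c * t) - 1) ≤ F / c := by
    rw [div_neg, neg_mul, ← mul_neg, neg_sub]
    have hnum : 0 ≤ F / c := div_nonneg hF hc.le
    calc F / c * (1 - Real.exp (-c * t)) ≤ F / c * 1 :=
          mul_le_mul_of_nonneg_left (by linarith) hnum
      _ = F / c := mul_one _
  linarith

/-- From an energy bound to an amplitude bound: `½x² ≤ E ≤ B λ^r` gives `|x| ≤ √(2B) λ^{r/2}`.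
[this file] -/
theorem forwardSmoothing_abs_le_of_energy {x E B r lam : ℝ} (hlam : 0 ≤ lam) (hB : 0 ≤ B)
    (hx : (1 / 2 : ℝ) * x ^ 2 ≤ E) (hE : E ≤ B * lam ^ r) :
    |x| ≤ Real.sqrt (2 * B) * lam ^ (r / 2) := by
  have h1 : x ^ 2 ≤ (2 * B) * lam ^ r := by linarith
  have h2 : |x| = Real.sqrt (x ^ 2) := (Real.sqrt_sq_eq_abs x).symm
  rw [h2]
  calc Real.sqrt (x ^ 2) ≤ Real.sqrt ((2 * B) * lam ^ r) := Real.sqrt_le_sqrt h1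
    _ = Real.sqrt (2 * B) * Real.sqrt (lam ^ r) := Real.sqrt_mul (by linarith) _
    _ = Real.sqrt (2 * B) * lam ^ (r / 2) := by
        rw [Real.sqrt_eq_rpow (lam ^ r), ← Real.rpow_mul hlam]
        congr 2
        ring

/-! ## §2 One bootstrap pass: the all-mode exponent gains `η/2` -/

/-- **One pass.** Cancelling table with `(0,0,1)` coefficients of modulus `≤ 1` vanishing off the
source set `S`; a regular solution of the `ν`-viscous lattice on `[0,s]` from a one-shell datum at
shell `0`; the `S`-ENVELOPE `Σ_{i∈S}½X_{i,k}² ≤ Cλ^{-(1+η)k}` (`η ≤ 1`) and an ALL-MODE bound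
`e_k ≤ Kλ^{-ak}` (`0 ≤ a ≤ 1`) at every shell `k ≥ 0` and time of `[0,s]`. Then
`e_k ≤ max(E₀, 128√(2C)K/ν) · λ^{-(a+η/2)k}` at every shell and time: the fluxes into and out of
shell `k ≥ 1` are `≤ 128√(2C)K λ^{(2−η/2−a)k}` and the shell dissipates at rate `2νλ^{2k}`.
[this file] -/
theorem forwardSmoothing_pass {ε₀ ν s η C K a : ℝ} (hε : 0 < ε₀) (hν : 0 < ν)
    (hη1 : η ≤ 1) (hC : 0 ≤ C) (hK : 0 ≤ K) (ha0 : 0 ≤ a) (ha1 : a ≤ 1)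
    {α : Fin 4 → Fin 4 → Fin 4 → ℤ × ℤ × ℤ → ℝ} (hc : IsCancellingCoeff α)
    (hα1 : ∀ i₁ i₂ i₃, |α i₁ i₂ i₃ (0, 0, 1)| ≤ 1)
    {S : Finset (Fin 4)} (hS : ∀ i, i ∉ S → ∀ j l : Fin 4, α i j l (0, 0, 1) = 0)
    {X₀ : Fin 4 → ℝ} {X : Fin 4 → ℤ → ℝ → ℝ}
    (hinit : ∀ (i : Fin 4) (k : ℤ), X i k 0 = if k = 0 then X₀ i else 0)
    (hlow : ∀ (i : Fin 4) (k : ℤ), k < 0 → ∀ t : ℝ, X i k t = 0)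
    {M : ℝ} (hM : ∀ (t : ℝ) (i : Fin 4) (k : ℤ), (1 + (1 + ε₀) ^ ((10 : ℝ) * k)) * |X i k t| ≤ M)
    (hder : ∀ (i : Fin 4) (k : ℤ), ∀ t ∈ Icc (0 : ℝ) s, HasDerivWithinAt (X i k)
      (quadTerm ε₀ α X i k t - ν * (1 + ε₀) ^ ((2 : ℝ) * k) * X i k t) (Icc (0 : ℝ) s) t)
    (hSenv : ∀ (k : ℕ), ∀ u ∈ Icc (0 : ℝ) s,
      ∑ i ∈ S, (1 / 2 : ℝ) * X i (k : ℤ) u ^ 2 ≤ C * (1 + ε₀) ^ (-((1 + η) * (k : ℝ))))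
    (hprev : ∀ (k : ℕ), ∀ u ∈ Icc (0 : ℝ) s,
      ∑ i : Fin 4, (1 / 2 : ℝ) * X i (k : ℤ) u ^ 2 ≤ K * (1 + ε₀) ^ (-(a * (k : ℝ))))
    (k : ℕ) {u : ℝ} (hu : u ∈ Icc (0 : ℝ) s) :
    ∑ i : Fin 4, (1 / 2 : ℝ) * X i (k : ℤ) u ^ 2 ≤
      max (∑ i : Fin 4, (1 / 2 : ℝ) * X₀ i ^ 2) (128 * Real.sqrt (2 * C) * K / ν) *
        (1 + ε₀) ^ (-((a + η / 2) * (k : ℝ))) := by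
  have h0 : (0 : ℝ) < 1 + ε₀ := by linarith
  have h1 : (1 : ℝ) ≤ 1 + ε₀ := by linarith
  set E₀ : ℝ := ∑ i : Fin 4, (1 / 2 : ℝ) * X₀ i ^ 2 with hE₀
  set Q : ℝ := 128 * Real.sqrt (2 * C) * K / ν with hQ
  have hsC : 0 ≤ Real.sqrt (2 * C) := Real.sqrt_nonneg _
  have hsK : 0 ≤ Real.sqrt (2 * K) := Real.sqrt_nonneg _
  have hQ0 : 0 ≤ Q := by positivity
  -- amplitude bounds from the two energy bounds
  have hampS : ∀ (j : ℕ), ∀ w ∈ Icc (0 : ℝ) s, ∀ i ∈ S,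
      |X i (j : ℤ) w| ≤ Real.sqrt (2 * C) * (1 + ε₀) ^ (-((1 + η) * (j : ℝ)) / 2) := by
    intro j w hw i hi
    have hsingle : (1 / 2 : ℝ) * X i (j : ℤ) w ^ 2 ≤ ∑ i' ∈ S, (1 / 2 : ℝ) * X i' (j : ℤ) w ^ 2 :=
      Finset.single_le_sum (f := fun i' => (1 / 2 : ℝ) * X i' (j : ℤ) w ^ 2)
        (fun i' _ => by positivity) hi
    exact forwardSmoothing_abs_le_of_energy h0.le hC hsingle (hSenv j w hw)
  have hamp : ∀ (j : ℕ), ∀ w ∈ Icc (0 : ℝ) s, ∀ i : Fin 4,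
      |X i (j : ℤ) w| ≤ Real.sqrt (2 * K) * (1 + ε₀) ^ (-(a * (j : ℝ)) / 2) := by
    intro j w hw i
    have hsingle : (1 / 2 : ℝ) * X i (j : ℤ) w ^ 2 ≤ ∑ i' : Fin 4, (1 / 2 : ℝ) * X i' (j : ℤ) w ^ 2 :=
      Finset.single_le_sum (f := fun i' => (1 / 2 : ℝ) * X i' (j : ℤ) w ^ 2)
        (fun i' _ => by positivity) (Finset.mem_univ i)
    exact forwardSmoothing_abs_le_of_energy h0.le hK hsingle (hprev j w hw)
  -- flux bound at every shell `j ≤ k`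
  set G : ℝ := 128 * Real.sqrt (2 * C) * K * (1 + ε₀) ^ ((2 - η / 2 - a) * (k : ℝ)) with hG
  have hG0 : 0 ≤ G := by positivity
  have hflux : ∀ j : ℕ, j ≤ k → ∀ w ∈ Icc (0 : ℝ) s, |botSum ε₀ α X (j : ℤ) w| ≤ G := by
    intro j hjk w hw
    have hA := hampS j w hw
    have hB := hamp j w hw
    have hB' : ∀ i : Fin 4,
        |X i ((j : ℤ) + 1) w| ≤ Real.sqrt (2 * K) * (1 + ε₀) ^ (-(a * ((j : ℝ) + 1)) / 2) := by
      intro i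
      have := hamp (j + 1) w hw i
      push_cast at this
      exact this
    have hb := forwardSmoothing_abs_botSum_le h0 hα1 hS
      (mul_nonneg hsC (Real.rpow_nonneg h0.le _)) (mul_nonneg hsK (Real.rpow_nonneg h0.le _))
      (mul_nonneg hsK (Real.rpow_nonneg h0.le _)) hA hB hB'
    have hjr : (j : ℝ) ≤ k := by exact_mod_cast hjk
    -- collect the powers of `1 + ε₀`
    have hpow : (1 + ε₀) ^ ((5 : ℝ) * ((j : ℤ) : ℝ) / 2) *
        (Real.sqrt (2 * C) * (1 + ε₀) ^ (-((1 + η) * (j : ℝ)) / 2) *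
          (Real.sqrt (2 * K) * (1 + ε₀) ^ (-(a * (j : ℝ)) / 2)) *
          (Real.sqrt (2 * K) * (1 + ε₀) ^ (-(a * ((j : ℝ) + 1)) / 2))) =
        Real.sqrt (2 * C) * (Real.sqrt (2 * K) * Real.sqrt (2 * K)) *
          (1 + ε₀) ^ ((2 - η / 2 - a) * (j : ℝ) - a / 2) := by
      have he : (5 : ℝ) * ((j : ℤ) : ℝ) / 2 + -((1 + η) * (j : ℝ)) / 2 + -(a * (j : ℝ)) / 2 +
          -(a * ((j : ℝ) + 1)) / 2 = (2 - η / 2 - a) * (j : ℝ) - a / 2 := by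
        push_cast
        ring
      rw [← he, Real.rpow_add h0, Real.rpow_add h0, Real.rpow_add h0]
      ring
    have hKK : Real.sqrt (2 * K) * Real.sqrt (2 * K) = 2 * K := Real.mul_self_sqrt (by linarith)
    have hexp : (1 + ε₀) ^ ((2 - η / 2 - a) * (j : ℝ) - a / 2) ≤
        (1 + ε₀) ^ ((2 - η / 2 - a) * (k : ℝ)) := by
      refine Real.rpow_le_rpow_of_exponent_le h1 ?_
      have hcoef : 0 ≤ 2 - η / 2 - a := by linarith
      nlinarith [mul_le_mul_of_nonneg_left hjr hcoef]
    calc |botSum ε₀ α X (j : ℤ) w|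
        ≤ 64 * (1 + ε₀) ^ ((5 : ℝ) * ((j : ℤ) : ℝ) / 2) *
            (Real.sqrt (2 * C) * (1 + ε₀) ^ (-((1 + η) * (j : ℝ)) / 2) *
              (Real.sqrt (2 * K) * (1 + ε₀) ^ (-(a * (j : ℝ)) / 2)) *
              (Real.sqrt (2 * K) * (1 + ε₀) ^ (-(a * ((j : ℝ) + 1)) / 2))) := hb
      _ = 64 * (Real.sqrt (2 * C) * (2 * K)) *
            (1 + ε₀) ^ ((2 - η / 2 - a) * (j : ℝ) - a / 2) := by
          rw [mul_assoc (64 : ℝ), hpow, hKK]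
          ring
      _ ≤ 64 * (Real.sqrt (2 * C) * (2 * K)) * (1 + ε₀) ^ ((2 - η / 2 - a) * (k : ℝ)) :=
          mul_le_mul_of_nonneg_left hexp (by positivity)
      _ = G := by simp only [hG]; ring
  -- the shell `k`: `k = 0` is the datum shell, `k ≥ 1` dissipates the incoming flux
  rcases Nat.eq_zero_or_pos k with hk | hk
  · subst hk
    have hsum : Summable fun j : ℕ => ∑ i : Fin 4, (1 / 2 : ℝ) * X i (j : ℤ) u ^ 2 :=
      (orthantBreak_summable hε hM 0 u).congr fun j => by simp
    have hle1 : ∑ i : Fin 4, (1 / 2 : ℝ) * X i ((0 : ℕ) : ℤ) u ^ 2 ≤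
        ∑' j : ℕ, ∑ i : Fin 4, (1 / 2 : ℝ) * X i (j : ℤ) u ^ 2 :=
      hsum.le_tsum 0 fun j _ => Finset.sum_nonneg fun i _ => by positivity
    have hle2 := orthantBreak_energy_le hε hν hc hinit hlow hM hder hu
    have hmax : E₀ ≤ max E₀ Q := le_max_left _ _
    calc ∑ i : Fin 4, (1 / 2 : ℝ) * X i ((0 : ℕ) : ℤ) u ^ 2 ≤ E₀ := hle1.trans hle2
      _ ≤ max E₀ Q * (1 + ε₀) ^ (-((a + η / 2) * ((0 : ℕ) : ℝ))) := by
          simp only [Nat.cast_zero, mul_zero, neg_zero, Real.rpow_zero, mul_one]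
          exact hmax
  · -- the energy of shell `k` and its differential inequality
    set f : ℝ → ℝ := fun w => ∑ i : Fin 4, (1 / 2 : ℝ) * X i (k : ℤ) w ^ 2 with hf
    set cν : ℝ := ν * (1 + ε₀) ^ ((2 : ℝ) * ((k : ℤ) : ℝ)) with hcν
    have hcν0 : 0 < cν := mul_pos hν (Real.rpow_pos_of_pos h0 _)
    have hderf : ∀ w ∈ Icc (0 : ℝ) s, HasDerivWithinAt f
        (botSum ε₀ α X ((k : ℤ) - 1) w - botSum ε₀ α X (k : ℤ) w -
          cν * ∑ i : Fin 4, X i (k : ℤ) w ^ 2) (Icc (0 : ℝ) s) w :=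
      fun w hw => forwardSmoothing_hasDerivWithinAt_shellEnergy hc hder (k : ℤ) hw
    have hbound : ∀ w ∈ Icc (0 : ℝ) s,
        botSum ε₀ α X ((k : ℤ) - 1) w - botSum ε₀ α X (k : ℤ) w -
          cν * ∑ i : Fin 4, X i (k : ℤ) w ^ 2 ≤ -(2 * cν) * f w + 2 * G := by
      intro w hw
      obtain ⟨m, rfl⟩ := Nat.exists_eq_add_of_le hk
      have hin : |botSum ε₀ α X (((1 + m : ℕ) : ℤ) - 1) w| ≤ G := by
        have := hflux m (by omega) w hw
        have hidx : (((1 + m : ℕ) : ℤ) - 1) = (m : ℤ) := by push_cast; ring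
        rw [hidx]
        exact this
      have hout : |botSum ε₀ α X ((1 + m : ℕ) : ℤ) w| ≤ G := hflux (1 + m) le_rfl w hw
      have hf2 : cν * ∑ i : Fin 4, X i ((1 + m : ℕ) : ℤ) w ^ 2 = 2 * cν * f w := by
        simp only [hf, Finset.mul_sum]
        refine Finset.sum_congr rfl fun i _ => ?_
        ring
      rw [hf2]
      have h1 := neg_abs_le (botSum ε₀ α X (((1 + m : ℕ) : ℤ) - 1) w)
      have h2 := le_abs_self (botSum ε₀ α X (((1 + m : ℕ) : ℤ) - 1) w)
      have h3 := neg_abs_le (botSum ε₀ α X ((1 + m : ℕ) : ℤ) w)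
      linarith
    have hf0 : f 0 ≤ 0 := by
      have : f 0 = 0 := by
        simp only [hf]
        refine Finset.sum_eq_zero fun i _ => ?_
        rw [hinit, if_neg (by exact_mod_cast hk.ne')]
        ring
      rw [this]
    have hdec := forwardSmoothing_le_of_linearDecay (mul_pos two_pos hcν0) (by positivity)
      hderf hbound hf0 hu
    -- identify the constant
    have hval : 2 * G / (2 * cν) = Q * (1 + ε₀) ^ (-((a + η / 2) * (k : ℝ))) := by
      have hsplit : (1 + ε₀) ^ ((2 - η / 2 - a) * (k : ℝ)) =
          (1 + ε₀) ^ (-((a + η / 2) * (k : ℝ))) * (1 + ε₀) ^ ((2 : ℝ) * ((k : ℤ) : ℝ)) := by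
        rw [← Real.rpow_add h0]
        congr 1
        push_cast
        ring
      have hpos : 0 < (1 + ε₀) ^ ((2 : ℝ) * ((k : ℤ) : ℝ)) := Real.rpow_pos_of_pos h0 _
      simp only [hG, hcν, hQ]
      rw [hsplit]
      field_simp
    have hmax : Q * (1 + ε₀) ^ (-((a + η / 2) * (k : ℝ))) ≤
        max E₀ Q * (1 + ε₀) ^ (-((a + η / 2) * (k : ℝ))) :=
      mul_le_mul_of_nonneg_right (le_max_right _ _) (Real.rpow_nonneg h0.le _)
    calc ∑ i : Fin 4, (1 / 2 : ℝ) * X i (k : ℤ) u ^ 2 = f u := rfl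
      _ ≤ 2 * G / (2 * cν) := hdec
      _ = Q * (1 + ε₀) ^ (-((a + η / 2) * (k : ℝ))) := hval
      _ ≤ _ := hmax

end Summit.NavierStokesRegularity.NavierStokesRegularity.Theorems

end
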